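import Literature.Combinatorics.SimpleGraph.BoxProdEdgePerfectMatchings
import Literature.Combinatorics.Enumerative.Hafnian
import Mathlib.Probability.ProbabilityMassFunction.Constructions

/-!
# The Gaussian-boson-sampling distribution of a graph, `μ_GBS,G(S) ∝ c^{2|S|} PM(G[S])²` (Anand–Chen–Cryan–Freifeld–Goldberg–Guo–Zhang 2025, eq. (1))

Cell `pub-qadeq` (summit `QuantumAdvantage`), CLAIMS rows A-192 / A-30 / E-72 (Gaussian-boson-sampling
graph applications) and §1 OPEN-70 (certification of the classical `G □ K₂` sampler: "TVD-checked
against brute-force `μ_GBS,G` on `n ≤ 16`").  Companion of `BoxProdEdgePerfectMatchings.lean`, whose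
`PMFun (G.induce S)` is the perfect-matching type counted here.
HONEST FRAMING: instance-level adjudication of specific advantage claims; no claim about BQP vs BPP
or the summit — this file is elementary finite probability on graphs and says nothing about any
experiment.

**Source.** K. Anand, Z. Chen, M. Cryan, G. Freifeld, L. A. Goldberg, H. Guo, X. Zhang, *Simulating
Gaussian boson sampling on graphs in polynomial time*, arXiv:2511.16558v2 (v2 25 Jun 2026)
[AnandChenCryanFreifeldGoldbergGuoZhang2025], §1 (materialised text `paper:arxiv-2511.16558`,
p0001 L30–L32 and p0002 L1–L4):

> "Given a graph `G = (V, E)` and a subset `S ⊆ V`, let `|S|` denote the size of `S` and let `PM(S)`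
> denote the number of perfect matchings in the induced subgraph `G[S]`. There is a positive real
> number `c` — specifically `c` is the inverse of the maximum norm of an eigenvalue of the adjacency
> matrix of `G`. Then the GBS distribution corresponding to `G` is defined as follows:
> `μ_GBS,G(S) ∝ c^{2|S|} PM(S)²`. (1)
> In GBS applications the number `c` is in the range `(0,1)` but in this paper we will not make any
> assumptions except that `c` is real and positive."

and §4 Lemma 4.1 / eq. (9) ("`= c^{2|S|} Haf[A_S]²`"), whose combinatorial content is the tree's
`BoxProdEdgePerfectMatchings.card_fibre_eq_sq` / `card_inLayer_eq`.

## Contents (all proved; 0 named facts, 0 sorry)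

* `pmCount G S` — `PM(S)`, the number of perfect matchings of `G[S]` (as `Nat.card (PMFun (G.induce S))`);
  `pmCount_empty : PM(∅) = 1`; `pmCount_eq_zero_of_odd : |S| odd → PM(S) = 0` (a perfect matching is a
  fixed-point-free involution, so it pairs the vertices — Mathlib's
  `Equiv.Perm.exists_fixed_point_of_prime` at `p = 2`).
* `gbsWeight G c S = c^{2|S|} · PM(S)²` — the unnormalised weight of eq. (1); `gbsWeight_nonneg`,
  `gbsWeight_empty = 1`, `gbsWeight_eq_zero_of_odd`, and
  `gbsWeight_eq_pow_mul_card_fibre : gbsWeight G c S = c^{2|S|} · |fibre of G □ K₂ over S|`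
  (Lemma 4.1's count, via `card_fibre_eq_sq`).
* `gbsPartitionFn G c = Σ_S gbsWeight G c S ≥ 1` (`one_le_gbsPartitionFn`, `gbsPartitionFn_pos`) — so
  the normalisation in eq. (1) is always possible, for every graph and every real `c`, the empty
  pattern carrying weight `1`.
* `muGBS G c S = gbsWeight G c S / gbsPartitionFn G c` — **the distribution `μ_GBS,G` of eq. (1)**:
  `muGBS_nonneg`, `sum_muGBS = 1`, `muGBS_eq_zero_of_odd` (odd patterns have probability `0`),
  `muGBS_mul_gbsWeight_comm` (the proportionality `μ(S)·w(T) = μ(T)·w(S)` that "∝" asserts),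
  `muGBS_pos_iff` (`μ(S) > 0 ↔ c ≠ 0 ∧ PM(S) ≠ 0`, or `S = ∅`).

* `pmFunEquiv H : PMFun H ≃ {τ ∈ perfectMatchings W | all pairs are H-edges}` — the partner maps of
  `BoxProdEdgePerfectMatchings.lean` ARE the fixed-point-free involutions of `Hafnian.lean` lying inside
  `H`; hence `natCard_pmFun_eq_hafnian : |PMFun H| = Haf(A(H))` (with the tree's
  `hafnian_adjMatrix01`), **`pmCount_eq_hafnian : PM(S) = Haf(A_S)`** for the `(0,1)` adjacency matrix
  `A_S` of `G[S]`, and **`gbsWeight_eq_pow_mul_hafnian_sq : c^{2|S|} PM(S)² = c^{2|S|} Haf(A_S)²`** —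
  the form "`= c^{2|S|} Haf[A_S]²`" of §4 eq. (9), i.e. the hafnian-squared reading of eq. (1) used by
  every GBS graph application.
* **Lemma 4.1, distributional form** (`sum_boxWeight_fibre_div_eq_muGBS`): give every perfect matching
  `σ` of `G □ K₂` the weight `boxWeight G c σ = c^{#vertices matched inside their layer}` (= the paper's
  `λ_e = c²` per `E ∪ E′` edge and `λ_e = 1` per rung); then the total weight of the fibre over `S` is
  `gbsWeight G c S` (`sum_boxWeight_fibre`), the normalising constants agree
  (`boxPartitionFn_eq_gbsPartitionFn`), and the law of `S_M` under the weighted perfect-matching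
  distribution `μ_PM,λ` on `G □ K₂` IS `μ_GBS,G` — "The induced distribution of `S_M` is exactly
  `μ_GBS,G(S)`" [§4 Lemma 4.1], here as an identity of finite sums (no Markov chain).
* Test vectors on the COMPLETE graph (section `CompleteGraph`): `natCard_pmFun_top` (on `K_W` every
  fixed-point-free involution is a perfect matching), `pmCount_top_of_even : PM_{K_V}(S) = (|S| − 1)!!`
  for even `|S|` (the tree's `card_perfectMatchings_of_even`, Björklund–Gupt–Quesada's `|PMP(n)| = (n−1)!!`),
  `pmCount_top_of_odd = 0`, `gbsWeight_top` (`c^{2|S|} ((|S|−1)!!)²` or `0`), and the kernel-checked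
  values `PM(K₂) = 1`, `PM(K₄) = 3`, `PM(K₆) = 15` (`pmCount_top_fin_two/four/six`) — reference numbers a
  brute-force implementation of eq. (1) must reproduce.
* `muGBSPMF G c : PMF (Finset V)` — `μ_GBS,G` packaged as a Mathlib probability mass function (so the
  tree's `PMF.tvDist`, the "ε-close in total variation distance" of Theorem 1.1, applies to it
  verbatim), with `muGBSPMF_apply_toReal = muGBS` and `mem_support_muGBSPMF_iff`.

Not formalised here: the identification of (1) with the photon-click law of a physical GBS device
programmed with the rescaled adjacency matrix `cA` (Hamilton et al. 2017 / Brádler et al. 2018 — the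
hafnian-squared output law of a Gaussian state), and anything about the sampling ALGORITHM of
Theorem 1.1 (a Markov chain on the perfect matchings of `G □ K₂`).
-/

namespace Literature.Combinatorics.SimpleGraph.GraphGBSDistribution

open Finset SimpleGraph
open Literature.Combinatorics.SimpleGraph.BoxProdEdgePerfectMatchings
open Literature.Combinatorics.Enumerative

variable {V : Type*} (G : SimpleGraph V)

section PM

/-! ### 1. `PM(S)`, the number of perfect matchings of the induced subgraph -/

/-- `PM(S)`: "the number of perfect matchings in the induced subgraph `G[S]`" (perfect matchings as
partner maps, `PMFun`). [cite: AnandChenCryanFreifeldGoldbergGuoZhang2025, §1 (notation before eq. (1))] -/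
noncomputable def pmCount (S : Finset V) : ℕ :=
  Nat.card (PMFun (G.induce (S : Set V)))

/-- A perfect matching (partner map) has no fixed point: a vertex is never its own partner, since
`H` is loopless. [folklore] -/
private theorem partner_ne_self {W : Type*} {H : SimpleGraph W} (σ : PMFun H) (w : W) :
    σ.1 w ≠ w := by
  intro h
  have hadj := σ.2.1 w
  rw [h] at hadj
  exact hadj.ne rfl

/-- On a finite vertex type of ODD cardinality there is no perfect matching (partner map): an
involution of a set of odd size has a fixed point. [folklore] -/
private theorem isEmpty_pmFun_of_odd {W : Type*} [Fintype W] [DecidableEq W] {H : SimpleGraph W}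
    (hodd : Odd (Fintype.card W)) : IsEmpty (PMFun H) := by
  refine ⟨fun σ => ?_⟩
  -- the partner map as a permutation of order dividing 2
  let τ : Equiv.Perm W := ⟨σ.1, σ.1, fun w => σ.2.2 w, fun w => σ.2.2 w⟩
  have hτ : τ ^ 2 ^ 1 = 1 := by
    ext w
    simp [τ, pow_succ, Equiv.Perm.mul_apply, σ.2.2 w]
  have hndvd : ¬ 2 ∣ Fintype.card W := by
    rw [← Nat.not_even_iff_odd, even_iff_two_dvd] at hodd
    exact hodd
  haveI : Fact (Nat.Prime 2) := ⟨Nat.prime_two⟩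
  obtain ⟨a, ha⟩ := Equiv.Perm.exists_fixed_point_of_prime hndvd hτ
  exact partner_ne_self σ a ha

/-- **`PM(S) = 0` for odd `|S|`**: an induced subgraph on an odd number of vertices has no perfect
matching, so odd patterns carry weight `0` in eq. (1). [cite: AnandChenCryanFreifeldGoldbergGuoZhang2025, §1 eq. (1) (with PM(S) the number of perfect matchings of G[S])] -/
theorem pmCount_eq_zero_of_odd (S : Finset V) (hS : Odd S.card) : pmCount G S = 0 := by
  classical
  unfold pmCount
  have hodd : Odd (Fintype.card (S : Set V)) := by
    simpa [Fintype.card_coe] using hS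
  haveI := isEmpty_pmFun_of_odd (H := G.induce (S : Set V)) hodd
  exact Nat.card_of_isEmpty

/-- **`PM(∅) = 1`**: the empty graph has exactly one perfect matching (the empty one), so the empty
pattern carries weight `c⁰ · 1 = 1` in eq. (1). [cite: AnandChenCryanFreifeldGoldbergGuoZhang2025, §1 eq. (1)] -/
theorem pmCount_empty : pmCount G (∅ : Finset V) = 1 := by
  unfold pmCount
  haveI : IsEmpty ((∅ : Finset V) : Set V) := by
    simp only [Finset.coe_empty]
    exact Set.isEmpty_coe_sort.mpr rfl
  haveI : Unique (PMFun (G.induce ((∅ : Finset V) : Set V))) :=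
    { default := ⟨fun x => isEmptyElim x, fun x => isEmptyElim x, fun x => isEmptyElim x⟩
      uniq := fun σ => Subtype.ext (funext fun x => isEmptyElim x) }
  exact Nat.card_unique

/-! ### 2. The weight `c^{2|S|} PM(S)²` and its normalisation -/

/-- The unnormalised GBS weight of a pattern `S`: `c^{2|S|} PM(S)²`.
[cite: AnandChenCryanFreifeldGoldbergGuoZhang2025, §1 eq. (1)] -/
noncomputable def gbsWeight (c : ℝ) (S : Finset V) : ℝ :=
  c ^ (2 * S.card) * (pmCount G S : ℝ) ^ 2

/-- The weight is an even power times a square, hence non-negative for every real `c`.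
[cite: AnandChenCryanFreifeldGoldbergGuoZhang2025, §1 eq. (1)] -/
theorem gbsWeight_nonneg (c : ℝ) (S : Finset V) : 0 ≤ gbsWeight G c S := by
  unfold gbsWeight
  have h1 : 0 ≤ c ^ (2 * S.card) := by
    rw [pow_mul]
    exact pow_nonneg (sq_nonneg c) _
  exact mul_nonneg h1 (sq_nonneg _)

/-- The empty pattern has weight `1`. [cite: AnandChenCryanFreifeldGoldbergGuoZhang2025, §1 eq. (1)] -/
theorem gbsWeight_empty (c : ℝ) : gbsWeight G c (∅ : Finset V) = 1 := by
  simp [gbsWeight, pmCount_empty]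

/-- Odd patterns have weight `0`. [cite: AnandChenCryanFreifeldGoldbergGuoZhang2025, §1 eq. (1)] -/
theorem gbsWeight_eq_zero_of_odd (c : ℝ) (S : Finset V) (hS : Odd S.card) :
    gbsWeight G c S = 0 := by
  simp [gbsWeight, pmCount_eq_zero_of_odd G S hS]

end PM

section Dist

variable [Fintype V]

/-- **Lemma 4.1's count.** The weight of `S` equals `c^{2|S|}` times the number of perfect matchings
of `G □ K₂` lying in the fibre over `S` (those whose in-layer-matched vertex set is `S`), since that
fibre has `PM(G[S])²` elements (`card_fibre_eq_sq`) and each of them weighs `c^{2|S|}`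
(`card_inLayer_eq`). [cite: AnandChenCryanFreifeldGoldbergGuoZhang2025, §4 Lemma 4.1 and eq. (9)] -/
theorem gbsWeight_eq_pow_mul_card_fibre [DecidableEq V] (c : ℝ) (S : Finset V) :
    gbsWeight G c S
      = c ^ (2 * S.card) * (Nat.card {σ : PMFun (boxK2 G) // layerSet σ = S} : ℝ) := by
  rw [gbsWeight, pmCount, card_fibre_eq_sq G S]
  push_cast
  ring

/-- The normalising constant of eq. (1): `Z = Σ_{S ⊆ V} c^{2|S|} PM(S)²`.
[cite: AnandChenCryanFreifeldGoldbergGuoZhang2025, §1 eq. (1) ("∝")] -/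
noncomputable def gbsPartitionFn (c : ℝ) : ℝ :=
  ∑ S : Finset V, gbsWeight G c S

/-- `Z ≥ 1` (the empty pattern alone contributes `1`, all other terms are `≥ 0`): the
proportionality (1) can be normalised for EVERY graph and every real `c`.
[cite: AnandChenCryanFreifeldGoldbergGuoZhang2025, §1 eq. (1)] -/
theorem one_le_gbsPartitionFn (c : ℝ) : 1 ≤ gbsPartitionFn G c := by
  unfold gbsPartitionFn
  rw [← gbsWeight_empty G c]
  exact Finset.single_le_sum (f := fun S => gbsWeight G c S) (fun S _ => gbsWeight_nonneg G c S)
    (Finset.mem_univ _)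

/-- `Z > 0`. [cite: AnandChenCryanFreifeldGoldbergGuoZhang2025, §1 eq. (1)] -/
theorem gbsPartitionFn_pos (c : ℝ) : 0 < gbsPartitionFn G c :=
  lt_of_lt_of_le one_pos (one_le_gbsPartitionFn G c)

/-! ### 3. The distribution `μ_GBS,G` -/

/-- **The GBS distribution of a graph**, `μ_GBS,G(S) = c^{2|S|} PM(S)² / Z` — eq. (1) normalised.
[cite: AnandChenCryanFreifeldGoldbergGuoZhang2025, §1 eq. (1)] -/
noncomputable def muGBS (c : ℝ) (S : Finset V) : ℝ :=
  gbsWeight G c S / gbsPartitionFn G c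

/-- `μ_GBS,G(S) ≥ 0`. [cite: AnandChenCryanFreifeldGoldbergGuoZhang2025, §1 eq. (1)] -/
theorem muGBS_nonneg (c : ℝ) (S : Finset V) : 0 ≤ muGBS G c S :=
  div_nonneg (gbsWeight_nonneg G c S) (gbsPartitionFn_pos G c).le

/-- `Σ_S μ_GBS,G(S) = 1`: eq. (1) defines a probability distribution on the subsets of `V`.
[cite: AnandChenCryanFreifeldGoldbergGuoZhang2025, §1 eq. (1)] -/
theorem sum_muGBS (c : ℝ) : ∑ S : Finset V, muGBS G c S = 1 := by
  unfold muGBS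
  rw [← Finset.sum_div]
  exact div_self (gbsPartitionFn_pos G c).ne'

/-- `μ_GBS,G(S) ≤ 1`. [cite: AnandChenCryanFreifeldGoldbergGuoZhang2025, §1 eq. (1)] -/
theorem muGBS_le_one (c : ℝ) (S : Finset V) : muGBS G c S ≤ 1 := by
  rw [← sum_muGBS G c]
  exact Finset.single_le_sum (f := fun T => muGBS G c T) (fun T _ => muGBS_nonneg G c T)
    (Finset.mem_univ S)

/-- Odd patterns have probability `0` under `μ_GBS,G`.
[cite: AnandChenCryanFreifeldGoldbergGuoZhang2025, §1 eq. (1)] -/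
theorem muGBS_eq_zero_of_odd (c : ℝ) (S : Finset V) (hS : Odd S.card) : muGBS G c S = 0 := by
  simp [muGBS, gbsWeight_eq_zero_of_odd G c S hS]

/-- The proportionality asserted by "∝" in eq. (1): `μ(S) · w(T) = μ(T) · w(S)` for all patterns.
[cite: AnandChenCryanFreifeldGoldbergGuoZhang2025, §1 eq. (1)] -/
theorem muGBS_mul_gbsWeight_comm (c : ℝ) (S T : Finset V) :
    muGBS G c S * gbsWeight G c T = muGBS G c T * gbsWeight G c S := by
  unfold muGBS
  rw [div_mul_eq_mul_div, div_mul_eq_mul_div, mul_comm]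

/-- The empty pattern has probability `1/Z`. [cite: AnandChenCryanFreifeldGoldbergGuoZhang2025, §1 eq. (1)] -/
theorem muGBS_empty (c : ℝ) : muGBS G c (∅ : Finset V) = (gbsPartitionFn G c)⁻¹ := by
  rw [muGBS, gbsWeight_empty, one_div]

/-- Support of `μ_GBS,G`: a pattern has positive probability iff its weight is non-zero, i.e. iff
`S = ∅`, or `c ≠ 0` and `G[S]` has a perfect matching.
[cite: AnandChenCryanFreifeldGoldbergGuoZhang2025, §1 eq. (1)] -/
theorem muGBS_pos_iff (c : ℝ) (S : Finset V) :
    0 < muGBS G c S ↔ S = ∅ ∨ (c ≠ 0 ∧ pmCount G S ≠ 0) := by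
  have hZ := gbsPartitionFn_pos G c
  rw [muGBS, div_pos_iff_of_pos_right hZ]
  constructor
  · intro h
    by_cases hS : S = ∅
    · exact Or.inl hS
    · right
      have hne : gbsWeight G c S ≠ 0 := h.ne'
      unfold gbsWeight at hne
      refine ⟨?_, ?_⟩
      · intro hc
        apply hne
        have hcard : S.card ≠ 0 := by
          rwa [Ne, Finset.card_eq_zero]
        rw [hc, zero_pow (by omega), zero_mul]
      · intro hpm
        apply hne
        rw [hpm]
        simp
  · rintro (hS | ⟨hc, hpm⟩)
    · rw [hS, gbsWeight_empty]
      exact one_pos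
    · have hw : gbsWeight G c S ≠ 0 := by
        unfold gbsWeight
        refine mul_ne_zero (pow_ne_zero _ hc) (pow_ne_zero _ ?_)
        exact_mod_cast hpm
      exact lt_of_le_of_ne (gbsWeight_nonneg G c S) hw.symm

end Dist

/-! ### 4. `PM(S) = Haf(A_S)`: partner maps are the perfect-matching involutions of `Hafnian.lean` -/

section HafnianBridge

variable {W : Type*} [Fintype W] [DecidableEq W] (H : SimpleGraph W) [DecidableRel H.Adj]

/-- The perfect matchings of `H` as partner maps (`PMFun H`) are in bijection with the fixed-point-free
involutive permutations of `W` all of whose pairs are `H`-edges — the members of `perfectMatchings W`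
(`Hafnian.lean`) lying inside `H`. [cite: AnandChenCryanFreifeldGoldbergGuoZhang2025, §2 eq. (4) and §4 eq. (9) ("Haf[A_S]")]; [folklore] -/
def pmFunEquiv :
    PMFun H ≃ {τ : Equiv.Perm W // τ ∈ (perfectMatchings W).filter (fun τ => ∀ v, H.Adj v (τ v))} where
  toFun σ := ⟨⟨σ.1, σ.1, fun w => σ.2.2 w, fun w => σ.2.2 w⟩, by
    rw [Finset.mem_filter, mem_perfectMatchings]
    exact ⟨⟨fun v => σ.2.2 v, fun v h => (σ.2.1 v).ne h.symm⟩, fun v => σ.2.1 v⟩⟩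
  invFun τ := ⟨τ.1, by
    have h := τ.2
    rw [Finset.mem_filter, mem_perfectMatchings] at h
    exact ⟨h.2, h.1.1⟩⟩
  left_inv σ := by rfl
  right_inv τ := by
    apply Subtype.ext
    ext w
    rfl

/-- `|PMFun H| = #{τ ∈ perfectMatchings W : every pair {v, τ v} is an H-edge}`.
[cite: AnandChenCryanFreifeldGoldbergGuoZhang2025, §1 ("PM(S) denote the number of perfect matchings in the induced subgraph G[S]")] -/
theorem natCard_pmFun :
    Nat.card (PMFun H) = ((perfectMatchings W).filter (fun τ => ∀ v, H.Adj v (τ v))).card := by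
  rw [Nat.card_congr (pmFunEquiv H), Nat.card_eq_fintype_card, Fintype.card_coe]

/-- **The number of perfect matchings of `H` is the hafnian of its `(0,1)` adjacency matrix**
(`hafnian_adjMatrix01` transported along `pmFunEquiv`). [cite: AnandChenCryanFreifeldGoldbergGuoZhang2025, §4 eq. (9) ("= c^{2|S|} Haf[A_S]²")] -/
theorem natCard_pmFun_eq_hafnian [LinearOrder W] {R : Type*} [CommSemiring R] :
    (Nat.card (PMFun H) : R) = hafnian (adjMatrix01 (R := R) H.Adj) := by
  rw [hafnian_adjMatrix01 H.Adj (fun u v h => H.adj_symm h), natCard_pmFun H]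

end HafnianBridge

section HafnianForm

variable [DecidableRel G.Adj]

/-- **`PM(S) = Haf(A_S)`** for the `(0,1)` adjacency matrix `A_S` of the induced subgraph `G[S]`
(indexed by the vertices of `S` in the order inherited from `V`).
[cite: AnandChenCryanFreifeldGoldbergGuoZhang2025, §4 eq. (9)] -/
theorem pmCount_eq_hafnian [LinearOrder V] {R : Type*} [CommSemiring R] (S : Finset V) :
    (pmCount G S : R) = hafnian (adjMatrix01 (R := R) (G.induce (S : Set V)).Adj) := by
  unfold pmCount
  exact natCard_pmFun_eq_hafnian (G.induce (S : Set V))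

/-- **`c^{2|S|} PM(S)² = c^{2|S|} Haf[A_S]²`** — eq. (1) in the hafnian form of §4 eq. (9), the
reading used by the GBS graph applications (densest subgraphs, perfect-matching counts, …).
[cite: AnandChenCryanFreifeldGoldbergGuoZhang2025, §4 eq. (9) ("= c^{2|S|} Haf[A_S]²")] -/
theorem gbsWeight_eq_pow_mul_hafnian_sq [LinearOrder V] (c : ℝ) (S : Finset V) :
    gbsWeight G c S
      = c ^ (2 * S.card) * (hafnian (adjMatrix01 (R := ℝ) (G.induce (S : Set V)).Adj)) ^ 2 := by
  rw [gbsWeight, pmCount_eq_hafnian G S]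

end HafnianForm


/-! ### 5. Lemma 4.1, distributional form: the law of `S_M` under `μ_PM,λ` on `G □ K₂` is `μ_GBS,G` -/

section Pushforward

/-- Partner maps on a finite vertex type form a finite type (a subtype of `W → W`). [folklore] -/
noncomputable instance instFintypePMFun {W : Type*} [Finite W] (H : SimpleGraph W) :
    Fintype (PMFun H) := by
  haveI : Finite (PMFun H) := by unfold PMFun; infer_instance
  exact Fintype.ofFinite _

variable [Fintype V] (c : ℝ)

/-- The weight of a perfect matching `σ` of `G □ K₂` in the sampler of Theorem 1.1: "for each edge
`e ∈ E ∪ E′`, let `λ_e = c²`, and for each `e ∈ E₀`, let `λ_e = 1`" — written as one factor `c` per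
vertex matched inside its own layer (two per `E ∪ E′` edge, none per rung).
[cite: AnandChenCryanFreifeldGoldbergGuoZhang2025, §4 (weights λ_e before Lemma 4.1) and §2 eq. (3)–(4)] -/
noncomputable def boxWeight (σ : PMFun (boxK2 G)) : ℝ :=
  c ^ (Finset.univ.filter fun x : V × Bool => (σ.1 x).2 = x.2).card

/-- `λ(σ) = c^{2|S_σ|}`: the weight depends on `σ` only through its layer set (`card_inLayer_eq`).
[cite: AnandChenCryanFreifeldGoldbergGuoZhang2025, §4 proof of Lemma 4.1] -/
theorem boxWeight_eq_pow (σ : PMFun (boxK2 G)) :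
    boxWeight G c σ = c ^ (2 * (layerSet σ).card) := by
  rw [boxWeight, card_inLayer_eq G (layerSet σ) σ rfl]

/-- `λ(σ) ≥ 0` (an even power). [cite: AnandChenCryanFreifeldGoldbergGuoZhang2025, §4] -/
theorem boxWeight_nonneg (σ : PMFun (boxK2 G)) : 0 ≤ boxWeight G c σ := by
  rw [boxWeight_eq_pow, pow_mul]
  exact pow_nonneg (sq_nonneg c) _

variable [DecidableEq V]

/-- **The fibre over `S` weighs `c^{2|S|} PM(S)²`**: summing `λ` over the perfect matchings of `G □ K₂`
whose layer set is `S` gives exactly the GBS weight of `S` ("`Σ_{M : S_M = S} Π_e λ_e = c^{2|S|} Haf[A_S]²`").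
[cite: AnandChenCryanFreifeldGoldbergGuoZhang2025, §4 Lemma 4.1, eq. (9)] -/
theorem sum_boxWeight_fibre (S : Finset V) :
    ∑ σ ∈ Finset.univ.filter (fun σ : PMFun (boxK2 G) => layerSet σ = S), boxWeight G c σ
      = gbsWeight G c S := by
  rw [gbsWeight_eq_pow_mul_card_fibre]
  rw [Finset.sum_congr rfl (fun σ hσ => by
    rw [boxWeight_eq_pow, (Finset.mem_filter.1 hσ).2])]
  rw [Finset.sum_const, nsmul_eq_mul, mul_comm]
  congr 1
  have h : Nat.card {σ : PMFun (boxK2 G) // layerSet σ = S}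
      = (Finset.univ.filter (fun σ : PMFun (boxK2 G) => layerSet σ = S)).card := by
    rw [Nat.card_eq_fintype_card, Fintype.card_subtype]
  exact_mod_cast h.symm

/-- The normalising constant of the weighted perfect-matching law `μ_PM,λ` on `G □ K₂`.
[cite: AnandChenCryanFreifeldGoldbergGuoZhang2025, §2 eq. (4)] -/
noncomputable def boxPartitionFn : ℝ := ∑ σ : PMFun (boxK2 G), boxWeight G c σ

/-- The two normalising constants agree: `Σ_σ λ(σ) = Σ_S c^{2|S|} PM(S)² = Z` (sum fibrewise).
[cite: AnandChenCryanFreifeldGoldbergGuoZhang2025, §4 Lemma 4.1] -/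
theorem boxPartitionFn_eq_gbsPartitionFn : boxPartitionFn G c = gbsPartitionFn G c := by
  unfold boxPartitionFn gbsPartitionFn
  rw [← Finset.sum_fiberwise Finset.univ (fun σ : PMFun (boxK2 G) => layerSet σ) (boxWeight G c)]
  exact Finset.sum_congr rfl fun S _ => sum_boxWeight_fibre G c S

/-- `Σ_σ λ(σ) > 0`. [cite: AnandChenCryanFreifeldGoldbergGuoZhang2025, §4 Lemma 4.1] -/
theorem boxPartitionFn_pos : 0 < boxPartitionFn G c := by
  rw [boxPartitionFn_eq_gbsPartitionFn]
  exact gbsPartitionFn_pos G c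

/-- **Lemma 4.1 (distributional form).** "Suppose that `M` is a sample from the perfect matching
distribution (4) on the graph `G □ K₂` with this weight function `λ`. Let `S_M ⊂ V` be the set of
vertices that are endpoints of some edge in `M ∩ E`. … The induced distribution of `S_M` is exactly
`μ_GBS,G(S)`": the `μ_PM,λ`-probability that the layer set equals `S` is `μ_GBS,G(S)`.
[cite: AnandChenCryanFreifeldGoldbergGuoZhang2025, §4 Lemma 4.1] -/
theorem sum_boxWeight_fibre_div_eq_muGBS (S : Finset V) :
    (∑ σ ∈ Finset.univ.filter (fun σ : PMFun (boxK2 G) => layerSet σ = S), boxWeight G c σ)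
        / boxPartitionFn G c = muGBS G c S := by
  rw [sum_boxWeight_fibre, boxPartitionFn_eq_gbsPartitionFn, muGBS]

end Pushforward


/-! ### 6. `μ_GBS,G` as a `PMF` (for total-variation statements such as Theorem 1.1's "ε-close") -/

section AsPMF

open scoped ENNReal

variable [Fintype V] (c : ℝ)

/-- `μ_GBS,G` as a probability mass function on the patterns `S ⊆ V`.
[cite: AnandChenCryanFreifeldGoldbergGuoZhang2025, §1 eq. (1) and Theorem 1.1 ("ε-close to μ_GBS,G in total variation distance")] -/
noncomputable def muGBSPMF : PMF (Finset V) :=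
  PMF.ofFintype (fun S => ENNReal.ofReal (muGBS G c S)) (by
    rw [← ENNReal.ofReal_sum_of_nonneg (fun S _ => muGBS_nonneg G c S), sum_muGBS, ENNReal.ofReal_one])

/-- Its mass at `S` is `μ_GBS,G(S)` (as an extended non-negative real).
[cite: AnandChenCryanFreifeldGoldbergGuoZhang2025, §1 eq. (1)] -/
theorem muGBSPMF_apply (S : Finset V) : muGBSPMF G c S = ENNReal.ofReal (muGBS G c S) := by
  simp [muGBSPMF]

/-- Its mass at `S`, read back in `ℝ`, is `μ_GBS,G(S)`. [cite: AnandChenCryanFreifeldGoldbergGuoZhang2025, §1 eq. (1)] -/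
theorem muGBSPMF_apply_toReal (S : Finset V) : (muGBSPMF G c S).toReal = muGBS G c S := by
  rw [muGBSPMF_apply, ENNReal.toReal_ofReal (muGBS_nonneg G c S)]

/-- Support of `μ_GBS,G`: `S = ∅`, or `c ≠ 0` and `G[S]` has a perfect matching (`muGBS_pos_iff`).
[cite: AnandChenCryanFreifeldGoldbergGuoZhang2025, §1 eq. (1)] -/
theorem mem_support_muGBSPMF_iff (S : Finset V) :
    S ∈ (muGBSPMF G c).support ↔ S = ∅ ∨ (c ≠ 0 ∧ pmCount G S ≠ 0) := by
  rw [PMF.mem_support_iff, muGBSPMF_apply, ← muGBS_pos_iff, ne_eq, ENNReal.ofReal_eq_zero, not_le]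

end AsPMF


/-! ### 7. Test vectors: the complete graph, `PM_{K}(S) = (|S| − 1)!!` -/

section CompleteGraph

/-- On the complete graph every fixed-point-free involution is a perfect matching:
`|PMFun K_W| = |perfectMatchings W|`. [cite: BjorklundGuptQuesada2019, §2 ("perfect matching permutations")]; [cite: AnandChenCryanFreifeldGoldbergGuoZhang2025, §1 (PM(S))] -/
theorem natCard_pmFun_top {W : Type*} [Fintype W] [DecidableEq W] :
    Nat.card (PMFun (⊤ : SimpleGraph W)) = (perfectMatchings W).card := by
  rw [natCard_pmFun (⊤ : SimpleGraph W)]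
  congr 1
  apply Finset.filter_true_of_mem
  intro τ hτ v
  rw [SimpleGraph.top_adj]
  exact ((mem_perfectMatchings.1 hτ).2 v).symm

/-- **`PM(K_n) = (n − 1)!!`** for even `n` (`card_perfectMatchings_of_even` of `Hafnian.lean`).
[cite: BjorklundGuptQuesada2019, §2 (display `|PMP(n)| = (n−1)!!`)] -/
theorem natCard_pmFun_top_of_even {W : Type*} [Fintype W] [DecidableEq W]
    (hW : Even (Fintype.card W)) :
    Nat.card (PMFun (⊤ : SimpleGraph W)) = Nat.doubleFactorial (Fintype.card W - 1) := by
  rw [natCard_pmFun_top, card_perfectMatchings_of_even hW]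

/-- An induced subgraph of a complete graph is complete. [folklore] -/
private theorem induce_top_eq (s : Set V) : (⊤ : SimpleGraph V).induce s = ⊤ := by
  ext a b
  simp

/-- **`PM_{K_V}(S) = (|S| − 1)!!`** for even `|S|`: on the complete graph the number of perfect matchings
of `G[S] = K_S` is the double factorial. [cite: BjorklundGuptQuesada2019, §2]; [cite: AnandChenCryanFreifeldGoldbergGuoZhang2025, §1 eq. (1)] -/
theorem pmCount_top_of_even [DecidableEq V] (S : Finset V) (hS : Even S.card) :
    pmCount (⊤ : SimpleGraph V) S = Nat.doubleFactorial (S.card - 1) := by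
  unfold pmCount
  rw [induce_top_eq]
  have h : Fintype.card (S : Set V) = S.card := by simp
  rw [natCard_pmFun_top_of_even (by rw [h]; exact hS), h]

/-- … and `PM_{K_V}(S) = 0` for odd `|S|`. [cite: AnandChenCryanFreifeldGoldbergGuoZhang2025, §1 eq. (1)] -/
theorem pmCount_top_of_odd (S : Finset V) (hS : Odd S.card) :
    pmCount (⊤ : SimpleGraph V) S = 0 :=
  pmCount_eq_zero_of_odd ⊤ S hS

/-- The GBS weight of a pattern on the complete graph: `c^{2|S|} ((|S| − 1)!!)²` for even `|S|`, else `0`.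
[cite: AnandChenCryanFreifeldGoldbergGuoZhang2025, §1 eq. (1)]; [cite: BjorklundGuptQuesada2019, §2] -/
theorem gbsWeight_top [DecidableEq V] (c : ℝ) (S : Finset V) :
    gbsWeight (⊤ : SimpleGraph V) c S
      = if Even S.card then c ^ (2 * S.card) * (Nat.doubleFactorial (S.card - 1) : ℝ) ^ 2 else 0 := by
  split_ifs with h
  · rw [gbsWeight, pmCount_top_of_even S h]
  · rw [gbsWeight_eq_zero_of_odd _ c S (Nat.not_even_iff_odd.1 h)]

/-- Test vector `PM(K₂) = 1`. [cite: BjorklundGuptQuesada2019, §2 ((n−1)!! with n = 2)] -/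
theorem pmCount_top_fin_two : pmCount (⊤ : SimpleGraph (Fin 2)) Finset.univ = 1 := by
  rw [pmCount_top_of_even _ (by simp)]; decide

/-- Test vector `PM(K₄) = 3`. [cite: BjorklundGuptQuesada2019, §2 ((n−1)!! with n = 4)] -/
theorem pmCount_top_fin_four : pmCount (⊤ : SimpleGraph (Fin 4)) Finset.univ = 3 := by
  rw [pmCount_top_of_even _ (by simp; decide)]; decide

/-- Test vector `PM(K₆) = 15`. [cite: BjorklundGuptQuesada2019, §2 ((n−1)!! with n = 6)] -/
theorem pmCount_top_fin_six : pmCount (⊤ : SimpleGraph (Fin 6)) Finset.univ = 15 := by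
  rw [pmCount_top_of_even _ (by simp; decide)]; decide

end CompleteGraph

end Literature.Combinatorics.SimpleGraph.GraphGBSDistribution
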